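import Literature.Barriers.CriticalPhenomena.HaraGaussianLemmaHeatKernel
import Mathlib.Analysis.Calculus.SmoothSeries
import Mathlib.MeasureTheory.Integral.IntervalIntegral.IntegrationByParts
import HarnessLib

/-!
# Integration by parts on the torus for Hara's `F_{n⃗}`: the identity (2.38)

Second file of the proof of Hara 2008, Lemma 2.3 (see `HaraGaussianLemmaHeatKernel.lean`). Hara:
"With the help of Fourier transform, we see for `l = 1, …, d`:
`x_l F_{n⃗}(x) = i^{n+1} ∫ e^{ikx} ∂_l[e^{-t{1-Ĵ(k)}} ∏_j {∂_jĴ(k)}^{n_j}] = t F_{n⃗'}(x) + Σ_p n_p (F_{n⃗''} * J_{p,l})(x)`,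
where `n⃗' = n⃗ + e_l` and `n⃗'' = n⃗ - e_p`" ((2.38)). PROVED here:

* `integral_cube_partialDeriv_eq_zero` — the integral over `[-π,π]^d` of a partial derivative of a
  coordinatewise `2π`-periodic `C¹` function vanishes (slice the cube with
  `MeasurableEquiv.piFinSuccAbove`, Fubini, fundamental theorem of calculus);
* derivatives along one coordinate: `∂_l(k·x) = x_l`, **`∂_l f̂ = -i (x_l f)^`** by termwise
  differentiation (`hasDerivAt_tsum`, dominated by `Σ|x_l f(x)|`), hence `∂_l e^{-t(1-Ĵ)}` and
  `∂_l ∏_j Ĵ_j^{n_j}`; continuity and periodicity of the integrand;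
* **(2.38) in `k`-space** (`coord_mul_integral_cexp_haraPhi`):
  `x_l ∫ e^{ikx}Φ_{n⃗} = t ∫ e^{ikx}Φ_{n⃗+e_l} + Σ_p n_p ∫ e^{ikx} Ĵ_{l,p} Φ_{n⃗-e_p}`;
* the exchange `∫ e^{ikx} â(k)Φ(k) dk = Σ_y a(y) ∫ e^{ik(x-y)}Φ(k) dk` for `a ∈ ℓ¹`, giving the
  convolution form `∫ e^{ikx} Ĵ_{l,p} Φ_{n⃗} dk/(2π)^d = Σ_y J_{l,p}(y) F_{n⃗}(x-y;t)`.

## References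

* T. Hara, Ann. Probab. 36 (2008) 530–593 (arXiv:math-ph/0504021): proof of Lemma 2.3, (2.38);
  §1.1 (Fourier conventions on `[-π,π]^d`).
-/

noncomputable section

namespace Literature.Barriers.CriticalPhenomena

open MeasureTheory Filter Finset Literature.Probability.LatticeModels Literature.Probability.Percolation
open scoped Topology BigOperators

variable {d : ℕ}


/-- Slicing the cube: `insertNth l s k' ∈ [-π,π]^{n+1} ↔ s ∈ [-π,π] ∧ k' ∈ [-π,π]^n`. [folklore] -/
theorem insertNth_mem_cube_iff {n : ℕ} (l : Fin (n + 1)) (s : ℝ) (k' : Fin n → ℝ) :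
    (l.insertNth s k' : Fin (n + 1) → ℝ) ∈ cube (n + 1) ↔ s ∈ Set.Icc (-Real.pi) Real.pi ∧ k' ∈ cube n := by
  simp only [cube, Set.mem_pi, Set.mem_univ, true_implies]
  rw [Fin.forall_iff_succAbove l]
  simp [Fin.insertNth_apply_same, Fin.insertNth_apply_succAbove]

/-- The preimage of the cube under the slicing equivalence is a product. [folklore] -/
theorem piFinSuccAbove_symm_preimage_cube {n : ℕ} (l : Fin (n + 1)) :
    (MeasurableEquiv.piFinSuccAbove (fun _ => ℝ) l).symm ⁻¹' cube (n + 1) =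
      Set.Icc (-Real.pi) Real.pi ×ˢ cube n := by
  ext p
  rw [Set.mem_preimage, Set.mem_prod]
  exact insertNth_mem_cube_iff l p.1 p.2

/-- **The integral over `[-π,π]^d` of a partial derivative of a coordinatewise-periodic `C¹` function
vanishes** (Fubini in the `l`-th coordinate and the fundamental theorem of calculus; the boundary
terms cancel by periodicity). This is the integration by parts behind "With the help of Fourier
transform, we see `x_l F_{n⃗}(x) = i^{n+1} ∫ e^{ikx} ∂_l[⋯]`". [cite: Hara2008, proof of Lemma 2.3, (2.38)] -/
theorem integral_cube_partialDeriv_eq_zero {n : ℕ} (l : Fin (n + 1)) {Ψ Ψ' : (Fin (n + 1) → ℝ) → ℂ}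
    (hderiv : ∀ (k' : Fin n → ℝ) (s : ℝ), HasDerivAt (fun u => Ψ (l.insertNth u k')) (Ψ' (l.insertNth s k')) s)
    (hcont : Continuous Ψ')
    (hper : ∀ k' : Fin n → ℝ, Ψ (l.insertNth Real.pi k') = Ψ (l.insertNth (-Real.pi) k')) :
    ∫ k in cube (n + 1), Ψ' k = 0 := by
  set e := MeasurableEquiv.piFinSuccAbove (fun _ : Fin (n + 1) => ℝ) l with he
  have hmp : MeasurePreserving e.symm volume volume := (volume_preserving_piFinSuccAbove (fun _ : Fin (n + 1) => ℝ) l).symm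
  have hsymm : ∀ p : ℝ × (Fin n → ℝ), e.symm p = l.insertNth p.1 p.2 := fun p => rfl
  -- transport to the product space
  have h1 : ∫ k in cube (n + 1), Ψ' k = ∫ p in Set.Icc (-Real.pi) Real.pi ×ˢ cube n, Ψ' (e.symm p) := by
    rw [← piFinSuccAbove_symm_preimage_cube l, hmp.setIntegral_preimage_emb e.symm.measurableEmbedding]
  rw [h1]
  -- integrability on the compact product
  have hG : Continuous fun p : ℝ × (Fin n → ℝ) => Ψ' (e.symm p) := by
    simp_rw [hsymm]
    exact hcont.comp (Continuous.finInsertNth l continuous_fst continuous_snd)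
  have hK : IsCompact (Set.Icc (-Real.pi) Real.pi ×ˢ cube n) :=
    isCompact_Icc.prod (isCompact_univ_pi fun _ => isCompact_Icc)
  have hGi : IntegrableOn (fun p : ℝ × (Fin n → ℝ) => Ψ' (e.symm p)) (Set.Icc (-Real.pi) Real.pi ×ˢ cube n) :=
    hG.continuousOn.integrableOn_compact hK
  -- Fubini with the `s`-integral inside
  rw [Measure.volume_eq_prod, ← Measure.prod_restrict, integral_prod_symm _ (by
    rw [Measure.prod_restrict]; exact hGi)]
  refine integral_eq_zero_of_ae (Eventually.of_forall fun k' => ?_)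
  -- the inner integral is a difference of boundary values
  simp only [hsymm]
  have hpi : -Real.pi ≤ Real.pi := by linarith [Real.pi_pos]
  rw [integral_Icc_eq_integral_Ioc, ← intervalIntegral.integral_of_le hpi]
  have hcs : Continuous fun s : ℝ => Ψ' (l.insertNth s k') :=
    hcont.comp (Continuous.finInsertNth l continuous_id continuous_const)
  rw [intervalIntegral.integral_eq_sub_of_hasDerivAt (fun s _ => hderiv k' s) (hcs.intervalIntegrable _ _), hper k',
    sub_self]
  rfl


/-! ### Derivatives along one coordinate of `k·x`, `f̂(k)`, `e^{-t(1-Ĵ)}` and `∏ Ĵ_j^{n_j}` -/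

section Slices

variable {n : ℕ}

/-- `(insertNth l s k')·x = s x_l + Σ_j k'_j x_{l.succAbove j}`. [folklore] -/
theorem kdot_insertNth (l : Fin (n + 1)) (s : ℝ) (k' : Fin n → ℝ) (x : Site (n + 1)) :
    kdot (l.insertNth s k' : Fin (n + 1) → ℝ) x =
      s * ((x l : ℤ) : ℝ) + kdot k' (fun j => x (l.succAbove j)) := by
  unfold kdot
  rw [Fin.sum_univ_succAbove _ l, Fin.insertNth_apply_same]
  congr 1
  exact Finset.sum_congr rfl fun j _ => by rw [Fin.insertNth_apply_succAbove]

/-- `d/ds [(insertNth l s k')·x] = x_l` (as a complex-valued function of the real variable `s`).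
[folklore] -/
theorem hasDerivAt_kdot_insertNth (l : Fin (n + 1)) (k' : Fin n → ℝ) (x : Site (n + 1)) (s : ℝ) :
    HasDerivAt (fun u : ℝ => ((kdot (l.insertNth u k' : Fin (n + 1) → ℝ) x : ℝ) : ℂ)) (((x l : ℤ) : ℝ) : ℂ) s := by
  simp_rw [kdot_insertNth]
  have h : HasDerivAt (fun u : ℝ => u * ((x l : ℤ) : ℝ) + kdot k' (fun j => x (l.succAbove j))) ((x l : ℤ) : ℝ) s :=
    (hasDerivAt_mul_const _).add_const _
  exact h.ofReal_comp

/-- Characters are `2π`-periodic in each coordinate on lattice points: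
`e^{±i(insertNth l π k')·y} = e^{±i(insertNth l (-π) k')·y}` for `y ∈ ℤ^d`. [folklore] -/
theorem cexp_kdot_insertNth_pi_eq (l : Fin (n + 1)) (k' : Fin n → ℝ) (y : Site (n + 1)) {ε : ℂ}
    (hε : ε = 1 ∨ ε = -1) :
    Complex.exp (ε * Complex.I * (kdot (l.insertNth Real.pi k' : Fin (n + 1) → ℝ) y : ℂ)) =
      Complex.exp (ε * Complex.I * (kdot (l.insertNth (-Real.pi) k' : Fin (n + 1) → ℝ) y : ℂ)) := by
  rw [kdot_insertNth, kdot_insertNth]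
  push_cast
  obtain ⟨m, hm⟩ : ∃ m : ℤ, (m : ℂ) = ε * (y l : ℤ) := by
    rcases hε with rfl | rfl
    · exact ⟨y l, by simp⟩
    · exact ⟨-(y l), by simp⟩
  rw [show ε * Complex.I * (↑Real.pi * ((y l : ℤ) : ℂ) + (kdot k' (fun j => y (l.succAbove j)) : ℂ)) =
      ε * Complex.I * (-↑Real.pi * ((y l : ℤ) : ℂ) + (kdot k' (fun j => y (l.succAbove j)) : ℂ)) +
        (ε * (y l : ℤ)) * (2 * Real.pi * Complex.I) by ring]
  rw [Complex.exp_add, ← hm, Complex.exp_int_mul_two_pi_mul_I, mul_one]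

/-- Hence `f̂` is `2π`-periodic in each coordinate. [folklore] -/
theorem latticeFT_insertNth_pi_eq (a : Site (n + 1) → ℝ) (l : Fin (n + 1)) (k' : Fin n → ℝ) :
    latticeFT a (l.insertNth Real.pi k') = latticeFT a (l.insertNth (-Real.pi) k') := by
  unfold latticeFT
  refine tsum_congr fun y => ?_
  have h := cexp_kdot_insertNth_pi_eq l k' y (ε := -1) (Or.inr rfl)
  simp only [neg_mul, one_mul] at h
  rw [h]

/-- **Differentiating `f̂` under the sum**: for `Σ|f| < ∞` and `Σ|y_l f(y)| < ∞`,
`∂/∂k_l f̂(k) = -i (y_l f)^(k)`, along the slice `k = insertNth l s k'`. [cite: Hara2008, proof of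
Lemma 2.1 ((2.28)–(2.29): termwise differentiation of Ĵ)] -/
theorem hasDerivAt_latticeFT_insertNth {a : Site (n + 1) → ℝ} (ha : Summable fun y => |a y|)
    (l : Fin (n + 1)) (ha1 : Summable fun y => |coordMul l a y|) (k' : Fin n → ℝ) (s : ℝ) :
    HasDerivAt (fun u : ℝ => latticeFT a (l.insertNth u k'))
      (-Complex.I * latticeFT (coordMul l a) (l.insertNth s k')) s := by
  set g : Site (n + 1) → ℝ → ℂ := fun y u =>
    (a y : ℂ) * Complex.exp (-(Complex.I * (kdot (l.insertNth u k' : Fin (n + 1) → ℝ) y : ℂ))) with hg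
  set g' : Site (n + 1) → ℝ → ℂ := fun y u =>
    (a y : ℂ) * (Complex.exp (-(Complex.I * (kdot (l.insertNth u k' : Fin (n + 1) → ℝ) y : ℂ))) *
      (-(Complex.I * (((y l : ℤ) : ℝ) : ℂ)))) with hg'
  have hderiv : ∀ y u, HasDerivAt (g y) (g' y u) u := by
    intro y u
    simp only [hg, hg']
    refine HasDerivAt.const_mul _ ?_
    exact ((hasDerivAt_kdot_insertNth l k' y u).const_mul Complex.I).neg.cexp
  have hbound : ∀ y u, ‖g' y u‖ ≤ |coordMul l a y| := by
    intro y u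
    simp only [hg', coordMul_apply]
    rw [norm_mul, norm_mul, Complex.norm_real, Complex.norm_exp, norm_neg, norm_mul, Complex.norm_I, one_mul,
      Complex.norm_real, Real.norm_eq_abs, Real.norm_eq_abs, abs_mul]
    have : (-(Complex.I * (kdot (l.insertNth u k' : Fin (n + 1) → ℝ) y : ℂ))).re = 0 := by simp
    rw [this, Real.exp_zero, one_mul, mul_comm]
  have h0 : Summable fun y => g y 0 := summable_latticeFT_term ha _
  have h := hasDerivAt_tsum ha1 hderiv hbound h0 s
  have he : ∑' y, g' y s = -Complex.I * latticeFT (coordMul l a) (l.insertNth s k') := by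
    rw [latticeFT, ← tsum_mul_left]
    refine tsum_congr fun y => ?_
    simp only [hg', coordMul_apply]
    push_cast
    ring
  rw [← he]
  exact h

variable {J : Site (n + 1) → ℝ}

/-- `∂/∂k_l e^{-t(1-Ĵ(k))} = e^{-t(1-Ĵ(k))} · t · (-i Ĵ_l(k))` along a slice. [cite: Hara2008, (2.38)
(the factor `t ∂_l Ĵ e^{-t(1-Ĵ)}`)] -/
theorem hasDerivAt_heatFT_insertNth (hJ : Summable fun y => |J y|) (h2 : Summable fun y => euclidNorm y ^ 2 * |J y|)
    (t : ℝ) (l : Fin (n + 1)) (k' : Fin n → ℝ) (s : ℝ) :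
    HasDerivAt (fun u : ℝ => heatFT J t (l.insertNth u k'))
      (heatFT J t (l.insertNth s k') * ((t : ℂ) * (-Complex.I * latticeFT (coordMul l J) (l.insertNth s k')))) s := by
  have h := hasDerivAt_latticeFT_insertNth hJ l (summable_abs_coordMul hJ h2 l) k' s
  have h1 : HasDerivAt (fun u : ℝ => -(t : ℂ) * (1 - latticeFT J (l.insertNth u k')))
      (-(t : ℂ) * (0 - -Complex.I * latticeFT (coordMul l J) (l.insertNth s k'))) s :=
    ((hasDerivAt_const s (1 : ℂ)).sub h).const_mul _
  have h2' := h1.cexp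
  simp only [heatFT]
  convert h2' using 1
  ring

/-- `∂/∂k_l ∏_j Ĵ_j(k)^{n_j} = Σ_p (∏_{j≠p} Ĵ_j^{n_j}) · n_p Ĵ_p^{n_p-1} · (-i Ĵ_{l,p}(k))` along a slice
(`Ĵ_{l,p}` the transform of `x_l x_p J(x)`). [cite: Hara2008, (2.38) (the factors `∂_l∂_pĴ`)] -/
theorem hasDerivAt_prod_latticeFT_insertNth (hJ : Summable fun y => |J y|)
    (h2 : Summable fun y => euclidNorm y ^ 2 * |J y|) (m : Fin (n + 1) → ℕ) (l : Fin (n + 1)) (k' : Fin n → ℝ) (s : ℝ) :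
    HasDerivAt (fun u : ℝ => ∏ j, latticeFT (coordMul j J) (l.insertNth u k') ^ (m j))
      (∑ p, (∏ j ∈ Finset.univ.erase p, latticeFT (coordMul j J) (l.insertNth s k') ^ (m j)) •
        ((m p : ℂ) * latticeFT (coordMul p J) (l.insertNth s k') ^ (m p - 1) *
          (-Complex.I * latticeFT (coordMul l (coordMul p J)) (l.insertNth s k')))) s := by
  classical
  have hf : ∀ p ∈ (Finset.univ : Finset (Fin (n + 1))),
      HasDerivAt (fun u : ℝ => latticeFT (coordMul p J) (l.insertNth u k') ^ (m p))
        ((m p : ℂ) * latticeFT (coordMul p J) (l.insertNth s k') ^ (m p - 1) *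
          (-Complex.I * latticeFT (coordMul l (coordMul p J)) (l.insertNth s k'))) s := by
    intro p _
    have h := hasDerivAt_latticeFT_insertNth (summable_abs_coordMul hJ h2 p) l
      (summable_abs_coordMul_coordMul h2 l p) k' s
    exact h.pow (m p)
  have h := HasDerivAt.finsetProd hf
  rw [Finset.prod_fn] at h
  exact h

/-! ### Continuity and periodicity of `Φ_{n⃗,t}` -/

/-- `e^{-t(1-Ĵ)}` is continuous. [folklore] -/
theorem continuous_heatFT {d : ℕ} {J : Site d → ℝ} (hJ : Summable fun y => |J y|) (t : ℝ) :
    Continuous (heatFT J t) := by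
  unfold heatFT
  exact Complex.continuous_exp.comp (continuous_const.mul (continuous_const.sub (continuous_latticeFT hJ)))

/-- `Φ_{n⃗,t}` is continuous. [folklore] -/
theorem continuous_haraPhi {d : ℕ} {J : Site d → ℝ} (hJ : Summable fun y => |J y|)
    (h2 : Summable fun y => euclidNorm y ^ 2 * |J y|) (t : ℝ) (m : Fin d → ℕ) :
    Continuous (haraPhi J t m) := by
  unfold haraPhi
  exact (continuous_heatFT hJ t).mul (continuous_finsetProd _ fun j _ =>
    (continuous_latticeFT (summable_abs_coordMul hJ h2 j)).pow _)

/-- `e^{ik·x} Φ_{n⃗,t}(k)` is integrable on the cube. [folklore] -/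
theorem integrableOn_cexp_mul_haraPhi {d : ℕ} {J : Site d → ℝ} (hJ : Summable fun y => |J y|)
    (h2 : Summable fun y => euclidNorm y ^ 2 * |J y|) (t : ℝ) (m : Fin d → ℕ) (x : Site d) :
    IntegrableOn (fun k => Complex.exp (Complex.I * (kdot k x : ℂ)) * haraPhi J t m k) (cube d) :=
  ((continuous_cexp_I_mul_kdot x).mul (continuous_haraPhi hJ h2 t m)).continuousOn.integrableOn_compact
    (isCompact_univ_pi fun _ => isCompact_Icc)

/-- `Φ_{n⃗,t}` is `2π`-periodic in each coordinate. [folklore] -/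
theorem haraPhi_insertNth_pi_eq (t : ℝ) (m : Fin (n + 1) → ℕ) (l : Fin (n + 1)) (k' : Fin n → ℝ) :
    haraPhi J t m (l.insertNth Real.pi k') = haraPhi J t m (l.insertNth (-Real.pi) k') := by
  unfold haraPhi heatFT
  rw [latticeFT_insertNth_pi_eq]
  congr 1
  exact Finset.prod_congr rfl fun j _ => by rw [latticeFT_insertNth_pi_eq]

/-- Raising one exponent: `∏_j g_j^{(m+e_l)_j} = g_l ∏_j g_j^{m_j}`. [folklore] -/
theorem prod_pow_update_succ {ι M : Type*} [Fintype ι] [DecidableEq ι] [CommMonoid M] (g : ι → M) (m : ι → ℕ) (l : ι) :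
    ∏ j, g j ^ Function.update m l (m l + 1) j = g l * ∏ j, g j ^ m j := by
  rw [← Finset.mul_prod_erase Finset.univ _ (Finset.mem_univ l), ← Finset.mul_prod_erase Finset.univ (fun j => g j ^ m j) (Finset.mem_univ l)]
  rw [Function.update_self, pow_succ]
  have h : ∏ j ∈ Finset.univ.erase l, g j ^ Function.update m l (m l + 1) j = ∏ j ∈ Finset.univ.erase l, g j ^ m j :=
    Finset.prod_congr rfl fun j hj => by rw [Function.update_of_ne (Finset.ne_of_mem_erase hj)]
  rw [h]
  simp only [mul_assoc, mul_comm]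

/-- Changing one exponent: `∏_j g_j^{(update m p c)_j} = g_p^c ∏_{j≠p} g_j^{m_j}`. [folklore] -/
theorem prod_pow_update {ι M : Type*} [Fintype ι] [DecidableEq ι] [CommMonoid M] (g : ι → M) (m : ι → ℕ) (p : ι) (c : ℕ) :
    ∏ j, g j ^ Function.update m p c j = g p ^ c * ∏ j ∈ Finset.univ.erase p, g j ^ m j := by
  rw [← Finset.mul_prod_erase Finset.univ _ (Finset.mem_univ p), Function.update_self]
  congr 1
  exact Finset.prod_congr rfl fun j hj => by rw [Function.update_of_ne (Finset.ne_of_mem_erase hj)]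

/-! ### The `k`-space identity behind `x_l F_{n⃗} = t F_{n⃗+e_l} + Σ_p n_p F_{n⃗-e_p} * J_{p,l}` -/

/-- **Integration by parts in `k_l`** (Hara 2008, (2.38)): for `x ∈ ℤ^d`,
`x_l ∫ e^{ikx} Φ_{n⃗,t} dk = t ∫ e^{ikx} Φ_{n⃗+e_l,t} dk + Σ_p n_p ∫ e^{ikx} Ĵ_{l,p}(k) Φ_{n⃗-e_p,t}(k) dk`
(`Ĵ_{l,p}` the transform of `x_l x_p J(x)`; `∂_lĴ = -iĴ_l`, `∂_lĴ_p = -iĴ_{l,p}`, and the boundary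
terms vanish by periodicity). [cite: Hara2008, proof of Lemma 2.3, (2.38)] -/
theorem coord_mul_integral_cexp_haraPhi (hJ : Summable fun y => |J y|) (h2 : Summable fun y => euclidNorm y ^ 2 * |J y|)
    (t : ℝ) (m : Fin (n + 1) → ℕ) (x : Site (n + 1)) (l : Fin (n + 1)) :
    ((x l : ℤ) : ℂ) * (∫ k in cube (n + 1), Complex.exp (Complex.I * (kdot k x : ℂ)) * haraPhi J t m k) =
      (t : ℂ) * (∫ k in cube (n + 1), Complex.exp (Complex.I * (kdot k x : ℂ)) * haraPhi J t (Function.update m l (m l + 1)) k) +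
      ∑ p, (m p : ℂ) * (∫ k in cube (n + 1), Complex.exp (Complex.I * (kdot k x : ℂ)) *
        (latticeFT (coordMul l (coordMul p J)) k * haraPhi J t (Function.update m p (m p - 1)) k)) := by
  classical
  -- notation
  set E : (Fin (n + 1) → ℝ) → ℂ := fun k => Complex.exp (Complex.I * (kdot k x : ℂ)) with hE
  set Jh : Fin (n + 1) → (Fin (n + 1) → ℝ) → ℂ := fun j k => latticeFT (coordMul j J) k with hJh
  set Jh2 : Fin (n + 1) → (Fin (n + 1) → ℝ) → ℂ := fun p k => latticeFT (coordMul l (coordMul p J)) k with hJh2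
  set P : (Fin (n + 1) → ℝ) → ℂ := fun k => ∏ j, Jh j k ^ (m j) with hP
  set P' : (Fin (n + 1) → ℝ) → ℂ := fun k => ∑ p, (∏ j ∈ Finset.univ.erase p, Jh j k ^ (m j)) •
    ((m p : ℂ) * Jh p k ^ (m p - 1) * (-Complex.I * Jh2 p k)) with hP'
  set Q : (Fin (n + 1) → ℝ) → ℂ := fun k =>
    heatFT J t k * ((t : ℂ) * (-Complex.I * Jh l k)) * P k + heatFT J t k * P' k with hQ
  set Ψ : (Fin (n + 1) → ℝ) → ℂ := fun k => E k * haraPhi J t m k with hΨ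
  set Ψ' : (Fin (n + 1) → ℝ) → ℂ := fun k => E k * (Complex.I * (((x l : ℤ) : ℝ) : ℂ)) * haraPhi J t m k + E k * Q k with hΨ'
  have hPhi : ∀ k, haraPhi J t m k = heatFT J t k * P k := fun k => rfl
  -- (i) the derivative along the `l`-th coordinate
  have hderiv : ∀ (k' : Fin n → ℝ) (s : ℝ), HasDerivAt (fun u => Ψ (l.insertNth u k')) (Ψ' (l.insertNth s k')) s := by
    intro k' s
    have hEd : HasDerivAt (fun u : ℝ => E (l.insertNth u k'))
        (E (l.insertNth s k') * (Complex.I * (((x l : ℤ) : ℝ) : ℂ))) s := by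
      simp only [hE]
      exact ((hasDerivAt_kdot_insertNth l k' x s).const_mul Complex.I).cexp
    have hΦd : HasDerivAt (fun u : ℝ => haraPhi J t m (l.insertNth u k')) (Q (l.insertNth s k')) s := by
      have h1 := hasDerivAt_heatFT_insertNth hJ h2 t l k' s
      have h2' := hasDerivAt_prod_latticeFT_insertNth hJ h2 m l k' s
      have h3 := h1.mul h2'
      simp only [hQ, hP, hP', hJh, hJh2]
      exact h3
    have h := hEd.mul hΦd
    simp only [hΨ, hΨ']
    exact h
  -- (ii) continuity of the derivative
  have hJhc : ∀ j, Continuous (Jh j) := fun j => continuous_latticeFT (summable_abs_coordMul hJ h2 j)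
  have hJh2c : ∀ p, Continuous (Jh2 p) := fun p => continuous_latticeFT (summable_abs_coordMul_coordMul h2 l p)
  have hPc : Continuous P := continuous_finsetProd _ fun j _ => (hJhc j).pow _
  have hP'c : Continuous P' := by
    refine continuous_finsetSum _ fun p _ => ?_
    refine (continuous_finsetProd _ fun j _ => (hJhc j).pow _).smul ?_
    exact ((continuous_const.mul ((hJhc p).pow _)).mul (continuous_const.mul (hJh2c p)))
  have hQc : Continuous Q := by
    simp only [hQ]
    have hh := continuous_heatFT hJ t
    exact ((hh.mul (continuous_const.mul (continuous_const.mul (hJhc l)))).mul hPc).add (hh.mul hP'c)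
  have hEc : Continuous E := continuous_cexp_I_mul_kdot x
  have hcont : Continuous Ψ' := by
    simp only [hΨ']
    exact ((hEc.mul continuous_const).mul (continuous_haraPhi hJ h2 t m)).add (hEc.mul hQc)
  -- (iii) periodicity
  have hper : ∀ k' : Fin n → ℝ, Ψ (l.insertNth Real.pi k') = Ψ (l.insertNth (-Real.pi) k') := by
    intro k'
    simp only [hΨ, hE]
    rw [haraPhi_insertNth_pi_eq]
    congr 1
    have h := cexp_kdot_insertNth_pi_eq l k' x (ε := 1) (Or.inl rfl)
    simpa only [one_mul] using h
  -- (iv) the integral of the derivative vanishes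
  have hzero := integral_cube_partialDeriv_eq_zero l hderiv hcont hper
  -- (v) algebra: identify the derivative
  have hQ' : ∀ k, E k * Q k = -Complex.I * ((t : ℂ) * (E k * haraPhi J t (Function.update m l (m l + 1)) k) +
      ∑ p, (m p : ℂ) * (E k * (Jh2 p k * haraPhi J t (Function.update m p (m p - 1)) k))) := by
    intro k
    have hplus : haraPhi J t (Function.update m l (m l + 1)) k = heatFT J t k * (Jh l k * P k) := by
      simp only [haraPhi, hP, hJh]
      rw [prod_pow_update_succ]
    have hminus : ∀ p, haraPhi J t (Function.update m p (m p - 1)) k =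
        heatFT J t k * (Jh p k ^ (m p - 1) * ∏ j ∈ Finset.univ.erase p, Jh j k ^ (m j)) := by
      intro p
      simp only [haraPhi, hJh]
      rw [prod_pow_update]
    have hsum : E k * (heatFT J t k * P' k) =
        -Complex.I * ∑ p, (m p : ℂ) * (E k * (Jh2 p k * haraPhi J t (Function.update m p (m p - 1)) k)) := by
      simp only [hP', smul_eq_mul, Finset.mul_sum]
      refine Finset.sum_congr rfl fun p _ => ?_
      rw [hminus p]
      ring
    rw [hplus]
    calc E k * Q k = E k * (heatFT J t k * ((t : ℂ) * (-Complex.I * Jh l k)) * P k) + E k * (heatFT J t k * P' k) := by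
          simp only [hQ]; ring
      _ = _ := by rw [hsum]; ring
  have hΨ'eq : Ψ' = fun k => Complex.I * ((((x l : ℤ) : ℝ) : ℂ) * (E k * haraPhi J t m k) -
      ((t : ℂ) * (E k * haraPhi J t (Function.update m l (m l + 1)) k) +
        ∑ p, (m p : ℂ) * (E k * (Jh2 p k * haraPhi J t (Function.update m p (m p - 1)) k)))) := by
    funext k
    simp only [hΨ']
    rw [add_comm, hQ' k]
    ring
  -- integrability of the pieces
  set μ : Measure (Fin (n + 1) → ℝ) := volume.restrict (cube (n + 1)) with hμ
  have hI0 : Integrable (fun k => (((x l : ℤ) : ℝ) : ℂ) * (E k * haraPhi J t m k)) μ :=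
    (integrableOn_cexp_mul_haraPhi hJ h2 t m x).const_mul _
  have hI1 : Integrable (fun k => (t : ℂ) * (E k * haraPhi J t (Function.update m l (m l + 1)) k)) μ :=
    (integrableOn_cexp_mul_haraPhi hJ h2 t (Function.update m l (m l + 1)) x).const_mul _
  have hI2 : ∀ p, Integrable (fun k => (m p : ℂ) * (E k * (Jh2 p k * haraPhi J t (Function.update m p (m p - 1)) k))) μ := by
    intro p
    refine Integrable.const_mul ?_ _
    exact ((hEc.mul ((hJh2c p).mul (continuous_haraPhi hJ h2 t _))).continuousOn.integrableOn_compact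
      (isCompact_univ_pi fun _ => isCompact_Icc))
  have hI3 : Integrable (fun k => (t : ℂ) * (E k * haraPhi J t (Function.update m l (m l + 1)) k) +
      ∑ p, (m p : ℂ) * (E k * (Jh2 p k * haraPhi J t (Function.update m p (m p - 1)) k))) μ :=
    hI1.add (integrable_finsetSum _ fun p _ => hI2 p)
  rw [hΨ'eq, integral_const_mul, mul_eq_zero] at hzero
  rcases hzero with hI | hzero
  · exact absurd hI Complex.I_ne_zero
  rw [integral_sub hI0 hI3, integral_add hI1 (integrable_finsetSum _ fun p _ => hI2 p),
    integral_finsetSum _ (fun p _ => hI2 p), sub_eq_zero] at hzero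
  simp only [integral_const_mul] at hzero
  simp only [hΨ, hE, hJh2] at hzero ⊢
  push_cast at hzero ⊢
  exact hzero

end Slices


/-! ### The convolution term: `∫ e^{ikx} Ĵ_{l,p} Φ dk/(2π)^d = Σ_y J_{l,p}(y) F(x-y)` -/

/-- **Exchange of sum and integral**: for `a ∈ ℓ¹(ℤ^d)` and `Φ` integrable on the cube,
`∫ e^{ik·x} â(k) Φ(k) dk = Σ_y a(y) ∫ e^{ik·(x-y)} Φ(k) dk` (dominated by `Σ|a| ∫|Φ|`). [folklore] -/
theorem integral_cexp_mul_latticeFT_mul {d : ℕ} {a : Site d → ℝ} (ha : Summable fun y => |a y|)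
    {Φ : (Fin d → ℝ) → ℂ} (hΦ : IntegrableOn Φ (cube d)) (x : Site d) :
    ∫ k in cube d, Complex.exp (Complex.I * (kdot k x : ℂ)) * (latticeFT a k * Φ k) =
      ∑' y, (a y : ℂ) * ∫ k in cube d, Complex.exp (Complex.I * (kdot k (x - y) : ℂ)) * Φ k := by
  set μ : Measure (Fin d → ℝ) := volume.restrict (cube d) with hμ
  set F : Site d → (Fin d → ℝ) → ℂ := fun y k => (a y : ℂ) * (Complex.exp (Complex.I * (kdot k (x - y) : ℂ)) * Φ k) with hF
  have hF_int : ∀ y, Integrable (F y) μ := fun y =>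
    ((hΦ.bdd_mul (continuous_cexp_I_mul_kdot (x - y)).aestronglyMeasurable
      (Eventually.of_forall fun k => (norm_cexp_I_mul_kdot k (x - y)).le))).const_mul _
  have hF_norm : ∀ y k, ‖F y k‖ = |a y| * ‖Φ k‖ := fun y k => by
    simp only [hF]; rw [norm_mul, norm_mul, Complex.norm_real, Real.norm_eq_abs, norm_cexp_I_mul_kdot, one_mul]
  have hF_sum : Summable fun y => ∫ k, ‖F y k‖ ∂μ := by
    have : (fun y => ∫ k, ‖F y k‖ ∂μ) = fun y => |a y| * ∫ k, ‖Φ k‖ ∂μ := by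
      funext y; simp_rw [hF_norm]; exact integral_const_mul _ _
    rw [this]; exact ha.mul_right _
  have hpt : ∀ k, Complex.exp (Complex.I * (kdot k x : ℂ)) * (latticeFT a k * Φ k) = ∑' y, F y k := by
    intro k
    simp only [hF, latticeFT]
    rw [← tsum_mul_right, ← tsum_mul_left]
    refine tsum_congr fun y => ?_
    rw [sub_eq_add_neg x y, kdot_add, kdot_neg, ← sub_eq_add_neg]; push_cast
    rw [mul_sub, Complex.exp_sub]
    have : Complex.exp (Complex.I * (kdot k y : ℂ)) ≠ 0 := Complex.exp_ne_zero _
    field_simp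
    rw [Complex.exp_neg]
    field_simp
  rw [integral_congr_ae (Eventually.of_forall hpt), ← integral_tsum_of_summable_integral_norm hF_int hF_sum]
  refine tsum_congr fun y => ?_
  simp only [hF]
  exact integral_const_mul _ _

/-- The convolution term of (2.38) in `x`-space:
`∫ e^{ikx} Ĵ_{l,p}(k) Φ_{n⃗,t}(k) dk/(2π)^d = Σ_y J_{l,p}(y) F_{n⃗}(x - y; t)`. [cite: Hara2008, (2.38)
(the term `(F_{n⃗''} * J_{p,l})(x)`)] -/
theorem integral_cexp_mul_latticeFT_haraPhi_eq_tsum {d : ℕ} {J : Site d → ℝ} (hJ : Summable fun y => |J y|)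
    (h2 : Summable fun y => euclidNorm y ^ 2 * |J y|) (t : ℝ) (m : Fin d → ℕ) (l p : Fin d) (x : Site d) :
    (∫ k in cube d, Complex.exp (Complex.I * (kdot k x : ℂ)) *
        (latticeFT (coordMul l (coordMul p J)) k * haraPhi J t m k)) / ((2 * Real.pi : ℂ) ^ d) =
      ∑' y, (coordMul l (coordMul p J) y : ℂ) * haraF J t m (x - y) := by
  have hΦ : IntegrableOn (haraPhi J t m) (cube d) :=
    (continuous_haraPhi hJ h2 t m).continuousOn.integrableOn_compact (isCompact_univ_pi fun _ => isCompact_Icc)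
  rw [integral_cexp_mul_latticeFT_mul (summable_abs_coordMul_coordMul h2 l p) hΦ x, ← tsum_div_const]
  refine tsum_congr fun y => ?_
  rw [haraF, mul_div_assoc]

/-! ### Crude bounds and the sup norm -/

end Literature.Barriers.CriticalPhenomena
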